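import Summits.NavierStokesRegularity.NavierStokesRegularity.Theorems.RecurrentProfilesRecurrentLiouvillePrScalingStabilizer
import Summits.NavierStokesRegularity.NavierStokesRegularity.Theorems.RecurrentProfilesRecurrentLiouvillePrStabilizerOfLimit
import Summits.NavierStokesRegularity.NavierStokesRegularity.Theorems.RecurrentProfilesRecurrentLiouvillePrRecurrentHullSymmetric
import HarnessLib

/-!
# Crux `RecurrentLiouville` (stmt-NavierStokesRegularity-1589), line `Sketch` v9 — stub T4:
# the HULL DICHOTOMY for recurrent Type-I singularity models

`stub_prHullDichotomy` (lead c11; composition of the landed stubs H4 `stub_prScalingStabilizer`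
p161016, T2 `stub_prStabilizerOfLimit` p162479 and T3 `stub_prRecurrentHullSymmetric` p163233).
Class: suitable weak solutions `(u, p)` of Navier–Stokes (`ν = 1`) on the backward slab `ℝ₋ × ℝ³`
with weak gradient `G`, Albritton–Barker bound `𝐈 ≤ M`, rate `‖u(t,x)‖ ≤ C/√(−t)`.  For every `C` and
`M < ⊤` there is `Λ > 1` such that every UNIFORMLY RECURRENT origin-singular class member `u` satisfies:

* (i) the SCALING STABILISER `Stab(w) = {σ | w_{e^σ} = w a.e. on the slab}` is a HULL INVARIANT: every
  `L³_loc`-limit `v` of rescalings `u_{λₙ}` (`λₙ > 0`; convergence in `L³(Q(0,R))` for every `R`) has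
  `Stab(v) = Stab(u)` — T2 gives `Stab(u) ⊆ Stab(v)`; T3 (Furstenberg 1.17: `u` is in turn an
  `L³_loc`-limit of rescalings of `v`) and T2 again give the converse;
* (ii) DICHOTOMY: either `u` is a.e. discretely self-similar with a LEAST factor `e^{σ₀} ≥ Λ`
  (`Stab(u) = σ₀ℤ`; the hull is the periodic orbit), or NO member of its hull is a.e. discretely
  self-similar for ANY factor (`Stab ≡ {0}` on the hull: aperiodic minimal hulls — quasi-periodic,
  weakly mixing, … — contain no DSS profile at all).  From H4 (`Stab(u)` is `{0}` or `σ₀ℤ`,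
  `σ₀ ≥ log Λ`) and (i).

Consequence for the portrait of a counterexample (crux docstring's "new regimes"): a Type-I
singularity model with an aperiodic recurrent hull has NO discretely self-similar blow-up limit, at
any scale factor; DSS-hunting inside such hulls is void.

## References

* H. Furstenberg, *Recurrence in Ergodic Theory and Combinatorial Number Theory* (1981), Ch. 1 §4,
  Thm. 1.17. [Furstenberg1981]
* D. Chae, J. Wolf, Comm. PDE 42 (2017), Thm 1.3. [ChaeWolf2017RemovingDSS]
* D. Albritton, T. Barker, J. Math. Fluid Mech. 21 (2019), no. 43 = arXiv:1811.00502, Lemma 2.2,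
  Prop. 2.3. [AlbrittonBarker2019]
-/

noncomputable section

-- the sub-problem namespace repeats the summit name (D-0017 layout `Summit.<S>.<P>.Theorems`)
set_option linter.dupNamespace false

namespace Summit.NavierStokesRegularity.NavierStokesRegularity.Theorems

open MeasureTheory Set Function Filter Topology TopologicalSpace Metric
open Literature.Analysis Literature.Analysis.FluidPDE
open scoped NNReal ENNReal

/-- **From the `(ε, R)`-approximation of T3 to a sequence converging in every `L³(Q(0,R))`.**  If for
every `ε > 0` and `R > 0` some rescaling `v_μ` (`μ > 0`) is `ε`-close to `u` in `L³(Q(0,R))`, then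
some sequence of rescalings `v_{μₖ}` converges to `u` in `L³(Q(0,R))` for every `R > 0`
(`μₖ` chosen for `ε = 1/(k+1)`, `R = k+1`; cylinders are monotone in the radius). [folklore] -/
theorem prHD_exists_seq_of_approx
    {u v : ℝ → EuclideanSpace ℝ (Fin 3) → EuclideanSpace ℝ (Fin 3)}
    (h : ∀ ε : ℝ, 0 < ε → ∀ R : ℝ, 0 < R → ∃ μ : ℝ, 0 < μ ∧
      eLpNorm (uncurry (nsRescale μ v) - uncurry u) 3
        (volume.restrict (parabolicCylinder R (0 : ℝ × EuclideanSpace ℝ (Fin 3)))) ≤ ENNReal.ofReal ε) :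
    ∃ μs : ℕ → ℝ, (∀ k, 0 < μs k) ∧ ∀ R : ℝ, 0 < R →
      Tendsto (fun k => eLpNorm (uncurry (nsRescale (μs k) v) - uncurry u) 3
        (volume.restrict (parabolicCylinder R (0 : ℝ × EuclideanSpace ℝ (Fin 3))))) atTop (𝓝 0) := by
  have hk : ∀ k : ℕ, (0 : ℝ) < 1 / ((k : ℝ) + 1) := fun k => by positivity
  choose μs hμs hle using fun k : ℕ => h _ (hk k) ((k : ℝ) + 1) (by positivity)
  refine ⟨μs, hμs, fun R hR => ?_⟩
  rw [ENNReal.tendsto_atTop_zero]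
  intro ε hε
  -- eventually `R ≤ k + 1` and `1/(k+1) ≤ ε`
  obtain ⟨N₁, hN₁⟩ := exists_nat_ge R
  have hε' : ∀ᶠ k : ℕ in atTop, ENNReal.ofReal (1 / ((k : ℝ) + 1)) ≤ ε := by
    have h0 : Tendsto (fun k : ℕ => ENNReal.ofReal (1 / ((k : ℝ) + 1))) atTop (𝓝 0) := by
      have h := ENNReal.tendsto_ofReal (tendsto_one_div_add_atTop_nhds_zero_nat (𝕜 := ℝ))
      rwa [ENNReal.ofReal_zero] at h
    exact (ENNReal.tendsto_atTop_zero.1 h0) ε hε |>.elim fun N hN => eventually_atTop.2 ⟨N, hN⟩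
  obtain ⟨N₂, hN₂⟩ := eventually_atTop.1 hε'
  refine ⟨max N₁ N₂, fun k hk' => ?_⟩
  have hk1 : N₁ ≤ k := le_of_max_le_left hk'
  have hk2 : N₂ ≤ k := le_of_max_le_right hk'
  have hsub : parabolicCylinder R (0 : ℝ × EuclideanSpace ℝ (Fin 3)) ⊆
      parabolicCylinder ((k : ℝ) + 1) (0 : ℝ × EuclideanSpace ℝ (Fin 3)) :=
    SuitableCompactness.parabolicCylinder_zero_mono hR.le
      (hN₁.trans ((Nat.cast_le.2 hk1).trans (le_add_of_nonneg_right zero_le_one)))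
  calc eLpNorm (uncurry (nsRescale (μs k) v) - uncurry u) 3
        (volume.restrict (parabolicCylinder R (0 : ℝ × EuclideanSpace ℝ (Fin 3))))
      ≤ eLpNorm (uncurry (nsRescale (μs k) v) - uncurry u) 3
          (volume.restrict (parabolicCylinder ((k : ℝ) + 1) (0 : ℝ × EuclideanSpace ℝ (Fin 3)))) :=
        eLpNorm_mono_measure _ (Measure.restrict_mono hsub le_rfl)
    _ ≤ ENNReal.ofReal (1 / ((k : ℝ) + 1)) := hle k
    _ ≤ ε := hN₂ k hk2

/-- **T4 · HULL DICHOTOMY FOR RECURRENT TYPE-I SINGULARITY MODELS** (registered stub of line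
`Sketch`, skeleton v9; composition of H4, T2, T3).  For every `C` and `M < ⊤` there is `Λ > 1` such
that for every UNIFORMLY RECURRENT origin-singular class member `u` with `𝐈 ≤ M`: (i) the scaling
stabiliser is a HULL INVARIANT — every `L³_loc`-limit `v` of rescalings of `u` has exactly the same
log-scales `σ` with `v_{e^σ} = v` a.e.; (ii) DICHOTOMY — either `u` is a.e. discretely
self-similar with a least factor `e^{σ₀} ≥ Λ` (its hull is the periodic orbit), or NO member of its
hull is a.e. discretely self-similar for ANY factor (aperiodic minimal hull: quasi-periodic, weakly
mixing, …). [cite: Furstenberg1981, Ch. 1 §4, Thm. 1.17; ChaeWolf2017RemovingDSS, Thm 1.3] -/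
theorem stub_prHullDichotomy :
    ∀ (C : ℝ) (M : ℝ≥0∞), M < ⊤ → ∃ Λ : ℝ, 1 < Λ ∧
      ∀ (u : ℝ → EuclideanSpace ℝ (Fin 3) → EuclideanSpace ℝ (Fin 3)) (p : ℝ → EuclideanSpace ℝ (Fin 3) → ℝ) (G : ℝ → EuclideanSpace ℝ (Fin 3) → EuclideanSpace ℝ (Fin 3) →L[ℝ] EuclideanSpace ℝ (Fin 3)),
        IsSuitableWeakSolutionOn (slab (EuclideanSpace ℝ (Fin 3)) (Iio 0) isOpen_Iio) 1 0 u p →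
        HasWeakSpatialGradientOn (slab (EuclideanSpace ℝ (Fin 3)) (Iio 0) isOpen_Iio) u G →
        typeIBound (Iio (0 : ℝ) ×ˢ univ) u p G ≤ M →
        HasTypeITimeDecay C u →
        IsBackwardSingularPoint u 0 →
        IsScalingUniformlyRecurrent u →
        (∀ (v : ℝ → EuclideanSpace ℝ (Fin 3) → EuclideanSpace ℝ (Fin 3)) (lam : ℕ → ℝ),
          (∀ R : ℝ, 0 < R → MemLp (uncurry v) 3 (volume.restrict (parabolicCylinder R (0 : ℝ × EuclideanSpace ℝ (Fin 3))))) →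
          (∀ n, 0 < lam n) →
          (∀ R : ℝ, 0 < R → Tendsto (fun n => eLpNorm (uncurry (nsRescale (lam n) u) - uncurry v) 3
            (volume.restrict (parabolicCylinder R (0 : ℝ × EuclideanSpace ℝ (Fin 3))))) atTop (𝓝 0)) →
          ∀ σ : ℝ, (∀ᵐ z ∂(volume.restrict (Iio (0 : ℝ) ×ˢ (univ : Set (EuclideanSpace ℝ (Fin 3))))), nsRescale (Real.exp σ) u z.1 z.2 = u z.1 z.2) ↔
            (∀ᵐ z ∂(volume.restrict (Iio (0 : ℝ) ×ˢ (univ : Set (EuclideanSpace ℝ (Fin 3))))), nsRescale (Real.exp σ) v z.1 z.2 = v z.1 z.2)) ∧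
        ((∃ σ₀ : ℝ, Real.log Λ ≤ σ₀ ∧ ∀ σ : ℝ,
            (∀ᵐ z ∂(volume.restrict (Iio (0 : ℝ) ×ˢ (univ : Set (EuclideanSpace ℝ (Fin 3))))), nsRescale (Real.exp σ) u z.1 z.2 = u z.1 z.2) ↔ ∃ k : ℤ, σ = (k : ℝ) * σ₀) ∨
         (∀ (v : ℝ → EuclideanSpace ℝ (Fin 3) → EuclideanSpace ℝ (Fin 3)) (lam : ℕ → ℝ),
          (∀ R : ℝ, 0 < R → MemLp (uncurry v) 3 (volume.restrict (parabolicCylinder R (0 : ℝ × EuclideanSpace ℝ (Fin 3))))) →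
          (∀ n, 0 < lam n) →
          (∀ R : ℝ, 0 < R → Tendsto (fun n => eLpNorm (uncurry (nsRescale (lam n) u) - uncurry v) 3
            (volume.restrict (parabolicCylinder R (0 : ℝ × EuclideanSpace ℝ (Fin 3))))) atTop (𝓝 0)) →
          ∀ σ : ℝ, (∀ᵐ z ∂(volume.restrict (Iio (0 : ℝ) ×ˢ (univ : Set (EuclideanSpace ℝ (Fin 3))))), nsRescale (Real.exp σ) v z.1 z.2 = v z.1 z.2) → σ = 0)) := by
  intro C M hM
  obtain ⟨Λ, hΛ1, hΛ⟩ := stub_prScalingStabilizer C M hM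
  refine ⟨Λ, hΛ1, ?_⟩
  intro u p G hsw hwg hI hdec hsing hrec
  have hI' : typeIBound (Iio (0 : ℝ) ×ˢ univ) u p G < ⊤ := lt_of_le_of_lt hI hM
  have hu : ∀ R : ℝ, 0 < R → MemLp (uncurry u) 3
      (volume.restrict (parabolicCylinder R (0 : ℝ × EuclideanSpace ℝ (Fin 3)))) :=
    fun R hR => memLp_three_of_slabProfile hwg hI' hR
  -- (i) the stabiliser is a hull invariant
  have hinv : ∀ (v : ℝ → EuclideanSpace ℝ (Fin 3) → EuclideanSpace ℝ (Fin 3)) (lam : ℕ → ℝ),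
      (∀ R : ℝ, 0 < R → MemLp (uncurry v) 3
        (volume.restrict (parabolicCylinder R (0 : ℝ × EuclideanSpace ℝ (Fin 3))))) →
      (∀ n, 0 < lam n) →
      (∀ R : ℝ, 0 < R → Tendsto (fun n => eLpNorm (uncurry (nsRescale (lam n) u) - uncurry v) 3
        (volume.restrict (parabolicCylinder R (0 : ℝ × EuclideanSpace ℝ (Fin 3))))) atTop (𝓝 0)) →
      ∀ σ : ℝ, (∀ᵐ z ∂(volume.restrict (Iio (0 : ℝ) ×ˢ (univ : Set (EuclideanSpace ℝ (Fin 3))))),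
          nsRescale (Real.exp σ) u z.1 z.2 = u z.1 z.2) ↔
        (∀ᵐ z ∂(volume.restrict (Iio (0 : ℝ) ×ˢ (univ : Set (EuclideanSpace ℝ (Fin 3))))),
          nsRescale (Real.exp σ) v z.1 z.2 = v z.1 z.2) := by
    intro v lam hv hlam hconv σ
    constructor
    · -- upper semicontinuity along the orbit closure (T2)
      exact stub_prStabilizerOfLimit u v lam hu hv hlam hconv σ
    · -- symmetry of the recurrent hull (T3) + T2 with the roles exchanged
      intro hσv
      obtain ⟨μs, hμs, hconv'⟩ := prHD_exists_seq_of_approx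
        (stub_prRecurrentHullSymmetric u v lam hu hv hlam hconv hrec)
      exact stub_prStabilizerOfLimit v u μs hv hu hμs hconv' σ hσv
  refine ⟨hinv, ?_⟩
  -- (ii) the dichotomy, from H4 and (i)
  rcases hΛ u p G hsw hwg hI hdec hsing with htriv | hcyc
  · right
    intro v lam hv hlam hconv σ hσv
    exact htriv σ ((hinv v lam hv hlam hconv σ).2 hσv)
  · left
    exact hcyc

end Summit.NavierStokesRegularity.NavierStokesRegularity.Theorems

end
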